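import Summits.SmoothPoincare4.SmoothPoincare4.Theses.InformationMetricHadamard
import Literature.Geometry.Riemannian.CartanHadamardConjugate
import Literature.Geometry.Riemannian.CartanHadamardLift
import Mathlib.Analysis.Convex.Deriv
import Mathlib.Analysis.SpecialFunctions.Sqrt

/-!
# Stub `stub_expDifferentialNormGe` of line `core-distance-morse` (crux `InformationMetricHadamard.C0AhRecognition`, stmt-SmoothPoincare4-6015)

**Rauch comparison for `K ≤ 0`, simplest case** (Lee 2018, Thm. 11.9 (a) with `c = 0`; do Carmo
1992, Ch. 10, Prop. 2.5): on a Riemannian manifold `(M, g)` (Hausdorff, no boundary) whose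
Levi-Civita connection is geodesically complete and whose curvature satisfies `Rm(X, Y, Y, X) ≤ 0`,
the differential of `exp_p` does not decrease lengths,
`g_p(w, w) ≤ g(d(exp_p)_v w, d(exp_p)_v w)`.

* `val_le_val_mfderiv_expMap` — the generic statement (any model `I`, any `C^n` metric `g`,
  `1 ≤ n`, with `C¹ ∩ C^∞` complete Levi-Civita connection), proved by the Jacobi-field argument
  of the tree's `CartanHadamard.mfderiv_expMap_injective` (`CartanHadamardConjugate.lean`, whose
  set-up is copied here): with `S(t) = d(exp_p)_{tv}(t w)` the variation field of
  `Γ(t, s) = γ_{v + s w}(t)`, `f = g(S, S)`, `a = g(D_t S, S)`, `b = |D_t S|²`, one has `f' = 2a`,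
  `a' = -Rm(S, T, T, S) + b ≥ b` and Cauchy–Schwarz `a² ≤ b f`; hence on `(0, ∞)` (where
  `f > 0` by `mfderiv_expMap_injective`) `ψ = √f` has `ψ' = a/ψ` and `(a/ψ)' = (a' f - a²)/ψ³ ≥ 0`,
  so `ψ` is convex on `[0, ∞)` with `ψ(0) = 0`, whence `ψ(s) ≤ s ψ(1)`, i.e.
  `|d(exp_p)_{sv} w|² = f(s)/s² ≤ f(1)` for `0 < s ≤ 1`; letting `s → 0⁺` along the continuous
  lift of `s ↦ d(exp_p)_{sv} w` (`continuous_lift_mfderiv_expMap_line`, continuity of `g` on `TM`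
  via `g.riemannianBundle`) and `d(exp_p)_0 = id` gives `g_p(w, w) ≤ f(1)`.
* `stub_expDifferentialNormGe` — the registered stub (`M = W⁵`, `I = 𝓡 5`, `n = ∞`). No definitions.
-/

noncomputable section

-- the prescribed namespace `Summit.<P>.<Sub>.…` duplicates `SmoothPoincare4` (P = Sub)
set_option linter.dupNamespace false

open scoped Manifold ContDiff Topology ENNReal NNReal
open Set Function Bundle

namespace Summit.SmoothPoincare4.SmoothPoincare4.Cruxes.C0AhRecognition.CoreDistanceMorse

open Literature.Topology.FourManifolds (HomotopySphere)
open Literature.Geometry.Lorentzian (PseudoRiemannianMetric IsGeodesicallyComplete)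
open Literature.Geometry.Riemannian (expMap)

section Generic

open Filter
open Literature.Geometry.Lorentzian
open Literature.Geometry.Lorentzian.PseudoRiemannianMetric
open Literature.Geometry.Riemannian
open Literature.Geometry.Riemannian.CartanHadamard

variable {E : Type*} [NormedAddCommGroup E] [NormedSpace ℝ E] {H : Type*} [TopologicalSpace H]
  {I : ModelWithCorners ℝ E H} {M : Type*} [TopologicalSpace M] [ChartedSpace H M]
  [IsManifold I ∞ M] {n : ℕ∞ω}
  {g : PseudoRiemannianMetric I n E (TangentSpace I : M → Type _)}

variable [Fact (1 ≤ n)] [FiniteDimensional ℝ E] [CompleteSpace E] [T2Space M] [I.Boundaryless]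
  [g.HasLeviCivita]
  [CovariantDerivative.ContMDiffCovariantDerivative g.leviCivita 1]
  [CovariantDerivative.ContMDiffCovariantDerivative g.leviCivita ∞]

omit [Fact (1 ≤ n)] in
/-- **`t ↦ |d(exp_p)_{tv}(w)|²_g` is continuous** for a Riemannian `g` with complete smooth
Levi-Civita connection: the curve `t ↦ (exp_p(tv), d(exp_p)_{tv} w)` is continuous in `TM`
(`CartanHadamard.continuous_lift_mfderiv_expMap_line`) and `g` is a continuous fibre metric
(Mathlib's `Continuous.inner_bundle` under `g.riemannianBundle`). [folklore] -/
theorem continuous_val_mfderiv_expMap_line (hg : g.IsRiemannian)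
    (hc : IsGeodesicallyComplete g.leviCivita) (p : M) (v w : E) :
    Continuous fun t : ℝ ↦ g.val (expMap g.leviCivita p (show TangentSpace I p from t • v))
      (mfderiv 𝓘(ℝ, E) I (fun u : E ↦ expMap g.leviCivita p (show TangentSpace I p from u))
        (t • v) w)
      (mfderiv 𝓘(ℝ, E) I (fun u : E ↦ expMap g.leviCivita p (show TangentSpace I p from u))
        (t • v) w) := by
  letI := g.riemannianBundle hg
  haveI := g.isContinuousRiemannianBundle hg
  have hL := continuous_lift_mfderiv_expMap_line (I := I) hc p v w
  have h := Continuous.inner_bundle (F := E) (E := fun x : M ↦ TangentSpace I x) hL hL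
  refine h.congr fun t ↦ ?_
  exact g.inner_eq hg _ _ _

/-- **The differential of `exp_p` does not decrease lengths under `Rm(X, Y, Y, X) ≤ 0`**
(Rauch comparison with the flat model, Lee 2018, Thm. 11.9 (a) for `c = 0`; do Carmo 1992,
Ch. 10, Prop. 2.5): for a positive definite `C^n` metric `g` (`1 ≤ n`) on a Hausdorff manifold
without boundary whose Levi-Civita connection is locally `C¹`, `C^∞` and geodesically complete,
and all `p ∈ M`, `v, w ∈ T_pM`, `g_p(w, w) ≤ g_{exp_p v}(d(exp_p)_v w, d(exp_p)_v w)`. Proof in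
the module docstring (`√g(S, S)` is convex for the Jacobi field `S(t) = d(exp_p)_{tv}(t w)`).
[cite: Lee2018, Thm. 11.9] -/
theorem val_le_val_mfderiv_expMap (hg : g.IsRiemannian)
    (hsec : ∀ (x : M) (X Y : TangentSpace I x), g.curvatureForm g.leviCivita x X Y Y X ≤ 0)
    (hcov₁ : g.leviCivita.IsLocallyContMDiff 1)
    (hc : IsGeodesicallyComplete g.leviCivita) (p : M) (v w : E) :
    g.val p w w ≤ g.val (expMap g.leviCivita p (show TangentSpace I p from v))
      (mfderiv 𝓘(ℝ, E) I (fun u : E ↦ expMap g.leviCivita p (show TangentSpace I p from u)) v w)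
      (mfderiv 𝓘(ℝ, E) I (fun u : E ↦ expMap g.leviCivita p (show TangentSpace I p from u))
        v w) := by
  -- the trivial case `w = 0`
  by_cases hw : w = 0
  · subst hw
    change g.val p (0 : TangentSpace I p) (0 : TangentSpace I p) ≤
      g.val (expMap g.leviCivita p (show TangentSpace I p from v))
        (mfderiv 𝓘(ℝ, E) I (fun u : E ↦ expMap g.leviCivita p (show TangentSpace I p from u)) v
          (0 : TangentSpace 𝓘(ℝ, E) v))
        (mfderiv 𝓘(ℝ, E) I (fun u : E ↦ expMap g.leviCivita p (show TangentSpace I p from u)) v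
          (0 : TangentSpace 𝓘(ℝ, E) v))
    simp
  have hLC := isLeviCivita_leviCivita_holds (g := g)
  have htors : g.leviCivita.torsion = 0 := hLC.1
  have hcompat : g.IsCompatible g.leviCivita := hLC.2
  have h2 : (2 : ℕ∞ω) ≤ (∞ : ℕ∞ω) := WithTop.coe_le_coe.2 le_top
  -- positive semidefiniteness
  have hnn : ∀ (x : M) (u : TangentSpace I x), 0 ≤ g.val x u u := fun x u ↦ by
    by_cases hu : u = 0
    · subst hu
      simp
    · exact (hg x u hu).le
  -- transport of `g_x(u, u')` along an equality of base points (all tangent spaces are `E`)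
  have hval : ∀ {x y : M}, x = y → ∀ u u' : E, g.val x u u' = g.val y u u' := by
    rintro x y rfl u u'
    rfl
  -- the differential along the ray, `Y t = d(exp_p)_{tv}(w)`, and `Φ = g(Y, Y)`
  set Y : Π t : ℝ, TangentSpace I (expMap g.leviCivita p (show TangentSpace I p from t • v)) :=
    fun t ↦ mfderiv 𝓘(ℝ, E) I (fun u : E ↦ expMap g.leviCivita p (show TangentSpace I p from u))
      (t • v) w with hY_def
  set Φ : ℝ → ℝ := fun t ↦
    g.val (expMap g.leviCivita p (show TangentSpace I p from t • v)) (Y t) (Y t) with hΦ_def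
  -- ### set-up copied from `CartanHadamard.mfderiv_expMap_injective`: `X t s = γ_{v + s w}(t)`
  let vT : TangentSpace I p := v
  let wT : TangentSpace I p := w
  set X : ℝ → ℝ → M := fun t s ↦ maximalGeodesic g.leviCivita p (vT + s • wT) t with hX_def
  have hXs : ContMDiff (𝓘(ℝ, ℝ).prod 𝓘(ℝ, ℝ)) I ∞ (uncurry X) :=
    contMDiff_uncurry_geodesicVariation hc p vT wT
  have hX2 : ∀ q : ℝ × ℝ, ContMDiffAt (𝓘(ℝ, ℝ).prod 𝓘(ℝ, ℝ)) I 2 (uncurry X) q :=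
    fun q ↦ (hXs q).of_le h2
  -- the curve `γ = X(·, 0)`, the fields `S = ∂_s X(·, 0)`, `T = ∂_t X(·, 0)`, `DS = D_t S`
  set γ : ℝ → M := fun t ↦ X t 0 with hγ_def
  set S : Π t : ℝ, TangentSpace I (γ t) := fun t ↦ velocity I (X t) 0 with hS_def
  set T : Π t : ℝ, TangentSpace I (γ t) := fun t ↦ velocity I γ t with hT_def
  set DS : Π t : ℝ, TangentSpace I (γ t) := fun t ↦ covariantDerivAlong g.leviCivita γ S t
    with hDS_def
  -- the Jacobi equation `D_t D_t S = -R(S, T) T`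
  have hjac : ∀ t₀ : ℝ, covariantDerivAlong g.leviCivita γ DS t₀ +
      g.leviCivita.curvature (γ t₀) (S t₀) (T t₀) (T t₀) = 0 :=
    fun t₀ ↦ jacobi_geodesicVariation hcov₁ htors hc p vT wT 0 t₀
  -- differentiability of the lifts of `S`, `T`, `DS`
  have hSl : ContMDiff 𝓘(ℝ, ℝ) I.tangent ∞
      (fun t ↦ (TotalSpace.mk' E (γ t) (S t) : TangentBundle I M)) :=
    contMDiff_lift_velocity_geodesicVariation hc p vT wT 0
  have hS : ∀ t, MDifferentiableAt 𝓘(ℝ, ℝ) I.tangent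
      (fun t ↦ (TotalSpace.mk' E (γ t) (S t) : TangentBundle I M)) t :=
    fun t ↦ (hSl t).mdifferentiableAt (by simp)
  have hT2 : ∀ q : ℝ × ℝ, ContMDiffAt (𝓘(ℝ, ℝ).prod 𝓘(ℝ, ℝ)) I.tangent 2
      (fun q : ℝ × ℝ ↦ (TotalSpace.mk' E (X q.1 q.2) (velocity I (fun t' ↦ X t' q.2) q.1) :
        TangentBundle I M)) q :=
    fun q ↦ ((contMDiff_tangentLift_geodesicVariation hc p vT wT) q).of_le h2
  have hsymm : ∀ t, covariantDerivAlong g.leviCivita γ S t =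
      covariantDerivAlong g.leviCivita (X t) (fun s ↦ velocity I (fun t' ↦ X t' s) t) 0 :=
    fun t ↦ covariantDerivAlong_velocity_comm g.leviCivita htors (hX2 (t, 0))
  have hDsT : ∀ t, MDifferentiableAt 𝓘(ℝ, ℝ) I.tangent (fun t' ↦ (TotalSpace.mk' E (X t' 0)
      (covariantDerivAlong g.leviCivita (X t') (fun s ↦ velocity I (fun t'' ↦ X t'' s) t') 0) :
        TangentBundle I M)) t :=
    fun t ↦ mdifferentiableAt_lift_covariantDerivAlong_curry_right g.leviCivita hcov₁
      (hX2 (t, 0)) (hT2 (t, 0))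
  have hDS : ∀ t, MDifferentiableAt 𝓘(ℝ, ℝ) I.tangent
      (fun t' ↦ (TotalSpace.mk' E (γ t') (DS t') : TangentBundle I M)) t := by
    intro t
    have heq : (fun t' ↦ (TotalSpace.mk' E (γ t') (DS t') : TangentBundle I M)) =
        fun t' ↦ (TotalSpace.mk' E (X t' 0) (covariantDerivAlong g.leviCivita (X t')
          (fun s ↦ velocity I (fun t'' ↦ X t'' s) t') 0) : TangentBundle I M) := by
      funext t'
      show (TotalSpace.mk' E (X t' 0) (covariantDerivAlong g.leviCivita γ S t') :
          TangentBundle I M) = _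
      rw [TotalSpace.mk_inj]
      exact hsymm t'
    rw [heq]
    exact hDsT t
  have hS0 : S 0 = 0 := velocity_geodesicVariation_zero hc p vT wT 0
  -- ### the real functions `f = g(S, S)`, `a = g(DS, S)`, `b = g(DS, DS)`, `c = g(D_t DS, S)`
  set f : ℝ → ℝ := fun t ↦ g.val (γ t) (S t) (S t) with hf_def
  set a : ℝ → ℝ := fun t ↦ g.val (γ t) (DS t) (S t) with ha_def
  set b : ℝ → ℝ := fun t ↦ g.val (γ t) (DS t) (DS t) with hb_def
  set c : ℝ → ℝ := fun t ↦ g.val (γ t) (covariantDerivAlong g.leviCivita γ DS t) (S t)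
    with hc_def
  have ha : ∀ t, HasDerivAt a (c t + b t) t :=
    fun t ↦ hasDerivAt_val_apply_along (g := g) hcompat (hDS t) (hS t)
  have hf : ∀ t, HasDerivAt f (2 * a t) t := by
    intro t
    have h := hasDerivAt_val_apply_along (g := g) hcompat (hS t) (hS t)
    have heq : g.val (γ t) (DS t) (S t) + g.val (γ t) (S t) (DS t) = 2 * a t := by
      rw [g.symm (γ t) (S t) (DS t)]
      show a t + a t = 2 * a t
      ring
    rwa [heq] at h
  -- `c = -Rm(S, T, T, S) ≥ 0`, `b ≥ 0`, `f ≥ 0`, Cauchy–Schwarz `a² ≤ b f`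
  have hc0 : ∀ t, 0 ≤ c t := by
    intro t
    have h1 : covariantDerivAlong g.leviCivita γ DS t =
        -g.leviCivita.curvature (γ t) (S t) (T t) (T t) :=
      eq_neg_of_add_eq_zero_left (hjac t)
    have h3 : c t = -g.curvatureForm g.leviCivita (γ t) (S t) (T t) (T t) (S t) := by
      show g.val (γ t) (covariantDerivAlong g.leviCivita γ DS t) (S t) = _
      rw [h1, map_neg]
      rfl
    rw [h3]
    exact neg_nonneg.2 (hsec (γ t) (S t) (T t))
  have hb0 : ∀ t, 0 ≤ b t := fun t ↦ hnn (γ t) (DS t)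
  have hf0 : ∀ t, 0 ≤ f t := fun t ↦ hnn (γ t) (S t)
  have hCS : ∀ t, a t ^ 2 ≤ b t * f t := fun t ↦ val_sq_le_mul g hnn (γ t) (DS t) (S t)
  -- ### identification `γ t = exp_p(t v)`, `S t = t • Y t`, `f t = t² Φ t`
  have hγ : ∀ t, γ t = expMap g.leviCivita p (show TangentSpace I p from t • v) := by
    intro t
    show maximalGeodesic g.leviCivita p (vT + (0 : ℝ) • wT) t = _
    rw [zero_smul, add_zero]
    exact (expMap_smul hc p vT t).symm
  have hSY : ∀ t, S t = t • Y t := by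
    intro t
    have h := velocity_geodesicVariation_eq_mfderiv_expMap hc p vT wT t
    show velocity I (fun s' : ℝ ↦ maximalGeodesic g.leviCivita p (vT + s' • wT) t) 0 = t • Y t
    rw [h]
    exact map_smul (mfderiv 𝓘(ℝ, E) I
      (fun u : E ↦ expMap g.leviCivita p (show TangentSpace I p from u)) (t • v)) t w
  have hfΦ : ∀ t, f t = t ^ 2 * Φ t := by
    intro t
    show g.val (γ t) (S t) (S t) =
      t ^ 2 * g.val (expMap g.leviCivita p (show TangentSpace I p from t • v)) (Y t) (Y t)
    rw [hSY t, hval (hγ t)]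
    simp only [map_smul, _root_.smul_apply, smul_eq_mul]
    ring
  -- `Y t ≠ 0` (injectivity of `d(exp_p)_{tv}`), hence `f > 0` off `t = 0`
  have hYne : ∀ t, Y t ≠ 0 := fun t h ↦
    hw ((injective_iff_map_eq_zero _).1
      (mfderiv_expMap_injective (I := I) hg hsec hcov₁ hc p (t • v)) w h)
  have hΦpos : ∀ t, 0 < Φ t := fun t ↦ hg _ (Y t) (hYne t)
  have hfpos : ∀ t, t ≠ 0 → 0 < f t := by
    intro t ht
    rw [hfΦ t]
    have h2t : 0 < t ^ 2 := by positivity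
    exact mul_pos h2t (hΦpos t)
  -- ### convexity of `ψ = √f` on `[0, ∞)`
  set ψ : ℝ → ℝ := fun t ↦ Real.sqrt (f t) with hψ_def
  have hψpos : ∀ t, 0 < t → 0 < ψ t := fun t ht ↦ Real.sqrt_pos.2 (hfpos t ht.ne')
  have hψsq : ∀ t, ψ t ^ 2 = f t := fun t ↦ Real.sq_sqrt (hf0 t)
  have hψ : ∀ t, 0 < t → HasDerivAt ψ (a t / ψ t) t := by
    intro t ht
    have h := (hf t).sqrt (hfpos t ht.ne').ne'
    have heq : 2 * a t / (2 * Real.sqrt (f t)) = a t / ψ t :=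
      mul_div_mul_left _ _ two_ne_zero
    rwa [heq] at h
  -- `φ = a / ψ = ψ'` is nondecreasing on `(0, ∞)`
  set φ : ℝ → ℝ := fun t ↦ a t / ψ t with hφ_def
  have hφ : ∀ t, 0 < t →
      HasDerivAt φ (((c t + b t) * ψ t - a t * (a t / ψ t)) / ψ t ^ 2) t :=
    fun t ht ↦ (ha t).div (hψ t ht) (hψpos t ht).ne'
  have hφ' : ∀ t, 0 < t → 0 ≤ ((c t + b t) * ψ t - a t * (a t / ψ t)) / ψ t ^ 2 := by
    intro t ht
    have hψt := hψpos t ht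
    refine div_nonneg ?_ (sq_nonneg _)
    have hnum : (c t + b t) * ψ t - a t * (a t / ψ t) =
        ((c t + b t) * f t - a t ^ 2) / ψ t := by
      rw [← hψsq t]
      field_simp
    rw [hnum]
    refine div_nonneg ?_ hψt.le
    nlinarith [hCS t, hc0 t, hf0 t]
  have hφmono : MonotoneOn φ (Ioi 0) := by
    refine monotoneOn_of_deriv_nonneg (convex_Ioi 0)
      (fun t ht ↦ (hφ t ht).continuousAt.continuousWithinAt) ?_ ?_
    · rw [interior_Ioi]
      exact fun t ht ↦ (hφ t ht).differentiableAt.differentiableWithinAt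
    · rw [interior_Ioi]
      intro t ht
      rw [(hφ t ht).deriv]
      exact hφ' t ht
  have hψcont : Continuous ψ := by
    have hfc : Continuous f := continuous_iff_continuousAt.2 fun t ↦ (hf t).continuousAt
    exact Real.continuous_sqrt.comp hfc
  have hψconv : ConvexOn ℝ (Ici 0) ψ := by
    refine MonotoneOn.convexOn_of_deriv (convex_Ici 0) hψcont.continuousOn ?_ ?_
    · rw [interior_Ici]
      exact fun t ht ↦ (hψ t ht).differentiableAt.differentiableWithinAt
    · rw [interior_Ici]
      exact hφmono.congr fun t ht ↦ ((hψ t ht).deriv).symm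
  -- ### `Φ s ≤ Φ 1` for `0 < s ≤ 1`
  have hψ0 : ψ 0 = 0 := by
    have h0 : f 0 = 0 := by
      rw [hfΦ 0]
      ring
    show Real.sqrt (f 0) = 0
    rw [h0, Real.sqrt_zero]
  have hkey : ∀ s ∈ Ioc (0 : ℝ) 1, Φ s ≤ Φ 1 := by
    intro s hs
    obtain ⟨hs0, hs1⟩ := hs
    have hcx := hψconv.2 (mem_Ici.2 le_rfl) (mem_Ici.2 zero_le_one) (sub_nonneg.2 hs1) hs0.le
      (sub_add_cancel 1 s)
    simp only [smul_eq_mul, mul_zero, zero_add, mul_one, hψ0] at hcx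
    -- `hcx : ψ s ≤ s * ψ 1`
    have h1 : f s ≤ s ^ 2 * f 1 := by
      calc f s = ψ s ^ 2 := (hψsq s).symm
        _ ≤ (s * ψ 1) ^ 2 := pow_le_pow_left₀ (hψpos s hs0).le hcx 2
        _ = s ^ 2 * f 1 := by rw [mul_pow, hψsq 1]
    rw [hfΦ s, hfΦ 1, one_pow, one_mul] at h1
    exact le_of_mul_le_mul_left h1 (pow_pos hs0 2)
  -- ### the limit `s → 0⁺`: `Φ 0 = g_p(w, w) ≤ Φ 1`
  have hΦc : Continuous Φ := continuous_val_mfderiv_expMap_line (I := I) hg hc p v w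
  have hΦ0 : Φ 0 = g.val p w w := by
    have hY0 : Y 0 = w := by
      show mfderiv 𝓘(ℝ, E) I (fun u : E ↦ expMap g.leviCivita p (show TangentSpace I p from u))
        ((0 : ℝ) • v) w = w
      rw [zero_smul]
      have h3 := DFunLike.congr_fun (hasMFDerivAt_expMap_zero (I := I) hc p).mfderiv w
      change mfderiv 𝓘(ℝ, E) I (fun u : E ↦ expMap g.leviCivita p (show TangentSpace I p from u))
        0 w = w at h3
      exact h3
    have hb : expMap g.leviCivita p (show TangentSpace I p from (0 : ℝ) • v) = p := by
      rw [zero_smul]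
      exact expMap_zero (cov := g.leviCivita) p
    show g.val (expMap g.leviCivita p (show TangentSpace I p from (0 : ℝ) • v)) (Y 0) (Y 0) =
      g.val p w w
    rw [hY0, hval hb]
  have hlim : Tendsto Φ (𝓝[>] 0) (𝓝 (Φ 0)) := (hΦc.tendsto 0).mono_left nhdsWithin_le_nhds
  have hev : ∀ᶠ s in 𝓝[>] (0 : ℝ), Φ s ≤ Φ 1 :=
    mem_of_superset (Ioc_mem_nhdsGT one_pos) fun s hs ↦ hkey s hs
  have hle : Φ 0 ≤ Φ 1 := le_of_tendsto hlim hev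
  rw [hΦ0] at hle
  have h1 : Φ 1 = g.val (expMap g.leviCivita p (show TangentSpace I p from v))
      (mfderiv 𝓘(ℝ, E) I (fun u : E ↦ expMap g.leviCivita p (show TangentSpace I p from u)) v w)
      (mfderiv 𝓘(ℝ, E) I (fun u : E ↦ expMap g.leviCivita p (show TangentSpace I p from u))
        v w) := by
    show g.val (expMap g.leviCivita p (show TangentSpace I p from (1 : ℝ) • v))
      (mfderiv 𝓘(ℝ, E) I (fun u : E ↦ expMap g.leviCivita p (show TangentSpace I p from u))
        ((1 : ℝ) • v) w)
      (mfderiv 𝓘(ℝ, E) I (fun u : E ↦ expMap g.leviCivita p (show TangentSpace I p from u))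
        ((1 : ℝ) • v) w) = _
    rw [one_smul]
  rwa [h1] at hle

end Generic

/-- **Stub R (`expDifferentialNormGe`, reshaped in by the lead, 2026-08-16).** On a Riemannian
manifold `(W, G)` (Hausdorff, no boundary) whose Levi-Civita connection is geodesically complete
and whose curvature satisfies `Rm(X, Y, Y, X) ≤ 0`, the differential of `exp_p` does not decrease
lengths: `G_p(w, w) ≤ G(d(exp_p)_v w, d(exp_p)_v w)` for all `p`, `v`, `w` (Lee 2018, Thm. 11.9
(Jacobi field comparison) for `c = 0`; do Carmo 1992, Ch. 10, Prop. 2.5). With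
`S(t) = d(exp_p)_{tv}(t w)` (the Jacobi field of the variation `γ_{v + s w}(t)`, `S(0) = 0`,
`D_t S(0) = w`), `f = G(S, S)`, `a = G(D_t S, S)`: `a' = |D_t S|² − Rm(S, T, T, S) ≥ |D_t S|²`,
`f' = 2a`, Cauchy–Schwarz `a² ≤ f · |D_t S|²`, so `√f` is convex on `[0, ∞)` and vanishes at `0`,
whence `t ↦ f(t)/t² = |d(exp_p)_{tv} w|²` is bounded by `f(1)` on `(0, 1]`; its limit at `0⁺` is
`G_p(w, w)` (`continuous_lift_mfderiv_expMap_line`, `hasMFDerivAt_expMap_zero`). The generic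
statement is `val_le_val_mfderiv_expMap`. [cite: Lee2018, Thm. 11.9] -/
theorem stub_expDifferentialNormGe
    (W : Type) [TopologicalSpace W] [T2Space W] [SecondCountableTopology W]
    [ChartedSpace (EuclideanSpace ℝ (Fin 5)) W] [IsManifold (𝓡 5) ∞ W]
    (G : PseudoRiemannianMetric (𝓡 5) ∞ (EuclideanSpace ℝ (Fin 5)) (TangentSpace (𝓡 5) : W → Type _))
    (hG : G.IsRiemannian) [G.HasLeviCivita]
    [CovariantDerivative.ContMDiffCovariantDerivative G.leviCivita 1]
    [CovariantDerivative.ContMDiffCovariantDerivative G.leviCivita ∞]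
    (hcov₁ : G.leviCivita.IsLocallyContMDiff 1)
    (hc : IsGeodesicallyComplete G.leviCivita)
    (hsec : ∀ (x : W) (X Y : TangentSpace (𝓡 5) x), G.curvatureForm G.leviCivita x X Y Y X ≤ 0)
    (p : W) (v w : EuclideanSpace ℝ (Fin 5)) :
    G.val p w w ≤
      G.val (expMap G.leviCivita p (show TangentSpace (𝓡 5) p from v))
        (mfderiv (𝓡 5) (𝓡 5)
          (fun u : EuclideanSpace ℝ (Fin 5) ↦ expMap G.leviCivita p (show TangentSpace (𝓡 5) p from u)) v w)
        (mfderiv (𝓡 5) (𝓡 5)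
          (fun u : EuclideanSpace ℝ (Fin 5) ↦ expMap G.leviCivita p (show TangentSpace (𝓡 5) p from u)) v w) :=
  val_le_val_mfderiv_expMap (I := 𝓡 5) (g := G) hG hsec hcov₁ hc p v w

end Summit.SmoothPoincare4.SmoothPoincare4.Cruxes.C0AhRecognition.CoreDistanceMorse

end
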